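import Mathlib.Probability.Distributions.Gaussian.Real
import Mathlib.MeasureTheory.Integral.Pi
import Mathlib.Analysis.Calculus.ContDiff.Basic
import Mathlib.Analysis.Calculus.MeanValue
import Mathlib.Algebra.Order.Chebyshev
import Mathlib.Topology.UniformSpace.HeineCantor
import HarnessLib

/-!
# The one-step Gaussian estimate `E f(x + ξ_h) = f(x) + (h/2) Δf(x) + o(h)` for `f ∈ C²_c(ℝᵈ)`

Topic `Probability/Process`. The elementary analytic half of Dynkin's formula for `d`-dimensional
Brownian motion (consumed in `BrownianVecDynkin`): for a standard Gaussian vector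
`ξ ~ N(0, h I_d)` on `ℝᵈ = Fin d → ℝ` (`gaussVec d h`, the product of `d` copies of Mathlib's
`gaussianReal 0 h`) and a function `f : ℝᵈ → ℝ` of class `C²` with compact support,

  `sup_x |E[f(x + ξ)] − f(x) − (h/2) Δf(x)| ≤ ε h`   for `0 < h < h₀(ε)`

(`gaussVec_integral_taylor`), where `Δf(x) = ∑ᵢ D²f(x)(eᵢ, eᵢ)` (`lap f x`, `hess f x = D²f(x)` the
second Fréchet derivative `fderiv (fderiv f)`). Proof: the second-order Taylor expansion along the
segment `t ↦ f(x + tξ)` by two applications of the mean value inequality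
(`abs_sub_taylor_two_le`: `|f(x+ξ) − f(x) − Df(x)ξ − ½D²f(x)(ξ,ξ)| ≤ B ‖ξ‖²` whenever
`‖D²f(y) − D²f(x)‖ ≤ B` on the segment), the Gaussian moments `E ξᵢ = 0`, `E ξᵢξⱼ = h δᵢⱼ`,
`E ξᵢ⁴ = m₄ h²` (`gaussVec_integral_*`), and the uniform continuity and boundedness of `D²f`
(compact support): `|R| ≤ η S + 2L S²/δ²` with `S = ∑ ξᵢ²`.

No named fact is introduced; every statement is proved (Mathlib: `gaussianReal`, `Measure.pi`,
`integral_fintype_prod_eq_prod`, `ContDiff`, `fderiv`, `norm_image_sub_le_of_norm_deriv_le_segment'`,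
`HasCompactSupport.uniformContinuous_of_continuous`).

## References

* J.-F. Le Gall, *Brownian Motion, Martingales, and Stochastic Calculus*, GTM 274, Springer
  (2016), Ch. 6, Thm. 6.14 and the Example following its proof ("In the case of d-dimensional
  Brownian motion [...] `h(X_t) − ½ ∫₀ᵗ Δh(X_s) ds` [...] is a martingale if we furthermore assume
  that `h` and `Δh` are in `C_0(ℝᵈ)`"; there via Itô's formula — here the elementary Gaussian
  Taylor estimate which replaces it), and Ch. 7 §7.1 (the Brownian semigroup `Q_t`,
  `Lψ = ½Δψ`). [Legall2016]
-/

noncomputable section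

open MeasureTheory ProbabilityTheory Filter Topology Set Finset
open scoped NNReal ENNReal BigOperators

namespace Literature.Probability.Process

/-! ### The standard Gaussian vector `N(0, h I_d)` on `Fin d → ℝ` and its moments -/

/-- **The centred Gaussian vector with covariance `h I_d`** on `ℝᵈ = Fin d → ℝ`: the product of
`d` independent `N(0, h)` (Mathlib `gaussianReal 0 h`). [folklore] -/
def gaussVec (d : ℕ) (h : ℝ≥0) : Measure (Fin d → ℝ) :=
  Measure.pi fun _ : Fin d ↦ gaussianReal 0 h

variable {d : ℕ} {h : ℝ≥0}

/-- `gaussVec d h` is a probability measure. [folklore] -/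
instance isProbabilityMeasure_gaussVec : IsProbabilityMeasure (gaussVec d h) := by
  unfold gaussVec; infer_instance

/-- The coordinates of `gaussVec d h` have law `N(0, h)`. [folklore] -/
theorem gaussVec_map_eval (i : Fin d) : (gaussVec d h).map (fun ξ ↦ ξ i) = gaussianReal 0 h := by
  classical
  have := Measure.pi_map_eval (μ := fun _ : Fin d ↦ gaussianReal 0 h) i
  simp only [measure_univ, Finset.prod_const_one, one_smul] at this
  simpa [gaussVec] using this

/-- Integrals of functions of one coordinate. [folklore] -/
theorem gaussVec_integral_comp_eval (i : Fin d) {g : ℝ → ℝ} (hg : Measurable g) :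
    ∫ ξ, g (ξ i) ∂gaussVec d h = ∫ x, g x ∂gaussianReal 0 h := by
  rw [← gaussVec_map_eval (h := h) i, integral_map (measurable_pi_apply i).aemeasurable
    hg.aestronglyMeasurable]

/-- Every power of a coordinate is integrable. [folklore] -/
theorem gaussVec_integrable_pow (i : Fin d) (n : ℕ) :
    Integrable (fun ξ : Fin d → ℝ ↦ ξ i ^ n) (gaussVec d h) := by
  have h1 : Integrable (fun x : ℝ ↦ x ^ n) (gaussianReal 0 h) := by
    have := (memLp_id_gaussianReal (μ := 0) (v := h) n).integrable_norm_pow'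
    simp only [id_eq, Real.norm_eq_abs] at this
    refine this.congr' (by fun_prop) (Eventually.of_forall fun x ↦ ?_)
    simp
  rw [← gaussVec_map_eval (h := h) i] at h1
  exact (integrable_map_measure h1.aestronglyMeasurable (measurable_pi_apply i).aemeasurable).1 h1

/-- `E ξᵢ = 0`. [folklore] -/
theorem gaussVec_integral_eval (i : Fin d) : ∫ ξ, ξ i ∂gaussVec d h = 0 := by
  have := gaussVec_integral_comp_eval (h := h) i measurable_id
  simpa [integral_id_gaussianReal] using this

/-- `E ξᵢ² = h`. [folklore] -/
theorem gaussVec_integral_sq (i : Fin d) : ∫ ξ, ξ i ^ 2 ∂gaussVec d h = h := by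
  rw [gaussVec_integral_comp_eval (h := h) i (g := fun x ↦ x ^ 2) (measurable_id.pow_const 2)]
  have hv := variance_of_integral_eq_zero (μ := gaussianReal 0 h) (X := id) measurable_id.aemeasurable
    (by simp [integral_id_gaussianReal])
  rw [variance_id_gaussianReal] at hv
  simpa using hv.symm

/-- `E ξᵢ ξⱼ = 0` for `i ≠ j` (independent centred coordinates). [folklore] -/
theorem gaussVec_integral_mul_of_ne {i j : Fin d} (hij : i ≠ j) :
    ∫ ξ, ξ i * ξ j ∂gaussVec d h = 0 := by
  classical
  -- write `ξ i * ξ j` as a product over all coordinates of one-variable functions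
  set g : Fin d → ℝ → ℝ := fun k x ↦ if k = i ∨ k = j then x else 1 with hg
  have hprod : ∀ ξ : Fin d → ℝ, ∏ k, g k (ξ k) = ξ i * ξ j := by
    intro ξ
    rw [← Finset.prod_filter_mul_prod_filter_not Finset.univ (fun k ↦ k = i ∨ k = j)]
    have h2 : (Finset.univ.filter fun k ↦ ¬(k = i ∨ k = j)).prod (fun k ↦ g k (ξ k)) = 1 :=
      Finset.prod_eq_one fun k hk ↦ by
        simp only [Finset.mem_filter, Finset.mem_univ, true_and] at hk
        simp [hg, hk]
    have h1 : (Finset.univ.filter fun k ↦ k = i ∨ k = j) = {i, j} := by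
      ext k; simp
    rw [h2, mul_one, h1, Finset.prod_pair hij]
    simp [hg]
  simp_rw [← hprod]
  rw [gaussVec, integral_fintype_prod_eq_prod]
  apply Finset.prod_eq_zero (Finset.mem_univ i)
  simp [hg, integral_id_gaussianReal]

/-- The fourth moment `m₄ = E X⁴` of the standard normal law. [folklore] -/
def gaussFourthMoment : ℝ := ∫ x, x ^ 4 ∂gaussianReal 0 1

/-- `m₄ ≥ 0`. [folklore] -/
theorem gaussFourthMoment_nonneg : 0 ≤ gaussFourthMoment :=
  integral_nonneg fun x ↦ by positivity

/-- `N(0, h)` is the image of `N(0, 1)` under `x ↦ √h x`. [folklore] -/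
theorem gaussianReal_eq_map_sqrt_mul (h : ℝ≥0) :
    gaussianReal 0 h = (gaussianReal 0 1).map (fun x ↦ Real.sqrt h * x) := by
  rw [gaussianReal_map_const_mul]
  congr 1
  · simp
  · ext
    simp [Real.sq_sqrt h.coe_nonneg]

/-- `E ξᵢ⁴ = m₄ h²`. [folklore] -/
theorem gaussVec_integral_pow_four (i : Fin d) :
    ∫ ξ, ξ i ^ 4 ∂gaussVec d h = gaussFourthMoment * (h : ℝ) ^ 2 := by
  rw [gaussVec_integral_comp_eval (h := h) i (g := fun x ↦ x ^ 4) (measurable_id.pow_const 4),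
    gaussianReal_eq_map_sqrt_mul h,
    integral_map (by fun_prop) (by fun_prop)]
  simp only [mul_pow]
  rw [integral_const_mul, gaussFourthMoment, mul_comm]
  congr 1
  rw [show (4 : ℕ) = 2 * 2 from rfl, pow_mul, Real.sq_sqrt h.coe_nonneg]

/-- The squared Euclidean-type size `S(ξ) = ∑ᵢ ξᵢ²`. [folklore] -/
def sqSum (ξ : Fin d → ℝ) : ℝ := ∑ i, ξ i ^ 2

/-- `S ≥ 0`. [folklore] -/
theorem sqSum_nonneg (ξ : Fin d → ℝ) : 0 ≤ sqSum ξ :=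
  Finset.sum_nonneg fun _ _ ↦ sq_nonneg _

/-- The sup norm is controlled by `S`: `‖ξ‖² ≤ ∑ᵢ ξᵢ²`. [folklore] -/
theorem norm_sq_le_sqSum (ξ : Fin d → ℝ) : ‖ξ‖ ^ 2 ≤ sqSum ξ := by
  have hle : ‖ξ‖ ≤ Real.sqrt (sqSum ξ) := by
    refine (pi_norm_le_iff_of_nonneg (Real.sqrt_nonneg _)).2 fun i ↦ ?_
    rw [Real.norm_eq_abs, ← Real.sqrt_sq_eq_abs]
    exact Real.sqrt_le_sqrt (Finset.single_le_sum (fun j _ ↦ sq_nonneg (ξ j)) (Finset.mem_univ i))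
  calc ‖ξ‖ ^ 2 ≤ (Real.sqrt (sqSum ξ)) ^ 2 := by gcongr
    _ = sqSum ξ := Real.sq_sqrt (sqSum_nonneg ξ)

/-- `S` is measurable. [folklore] -/
theorem measurable_sqSum : Measurable (sqSum : (Fin d → ℝ) → ℝ) :=
  Finset.measurable_sum _ fun i _ ↦ (measurable_pi_apply i).pow_const 2

/-- `S` is continuous. [folklore] -/
theorem continuous_sqSum : Continuous (sqSum : (Fin d → ℝ) → ℝ) :=
  continuous_finsetSum _ fun i _ ↦ (continuous_apply i).pow 2

/-- `S` is integrable. [folklore] -/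
theorem integrable_sqSum : Integrable (sqSum : (Fin d → ℝ) → ℝ) (gaussVec d h) :=
  integrable_finsetSum _ fun i _ ↦ gaussVec_integrable_pow i 2

/-- `E S = d h`. [folklore] -/
theorem gaussVec_integral_sqSum : ∫ ξ, sqSum ξ ∂gaussVec d h = d * h := by
  unfold sqSum
  rw [integral_finsetSum _ fun i _ ↦ gaussVec_integrable_pow i 2]
  simp [gaussVec_integral_sq]

/-- `S² ≤ d ∑ᵢ ξᵢ⁴` (Cauchy–Schwarz). [folklore] -/
theorem sqSum_sq_le (ξ : Fin d → ℝ) : sqSum ξ ^ 2 ≤ d * ∑ i, ξ i ^ 4 := by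
  have := sq_sum_le_card_mul_sum_sq (s := Finset.univ) (f := fun i : Fin d ↦ ξ i ^ 2)
  simp only [Finset.card_univ, Fintype.card_fin, ← pow_mul] at this
  simpa [sqSum] using this

/-- `∑ᵢ ξᵢ⁴` is integrable. [folklore] -/
theorem integrable_sum_pow_four : Integrable (fun ξ : Fin d → ℝ ↦ ∑ i, ξ i ^ 4) (gaussVec d h) :=
  integrable_finsetSum _ fun i _ ↦ gaussVec_integrable_pow (h := h) i 4

/-- `S²` is integrable. [folklore] -/
theorem integrable_sqSum_sq : Integrable (fun ξ : Fin d → ℝ ↦ sqSum ξ ^ 2) (gaussVec d h) := by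
  refine Integrable.mono' ((integrable_sum_pow_four (h := h)).const_mul (d : ℝ))
    (measurable_sqSum.pow_const 2).aestronglyMeasurable (Eventually.of_forall fun ξ ↦ ?_)
  rw [Real.norm_eq_abs, abs_of_nonneg (sq_nonneg _)]
  exact sqSum_sq_le ξ

/-- `E S² ≤ d² m₄ h²`. [folklore] -/
theorem gaussVec_integral_sqSum_sq_le :
    ∫ ξ, sqSum ξ ^ 2 ∂gaussVec d h ≤ d ^ 2 * gaussFourthMoment * (h : ℝ) ^ 2 := by
  calc ∫ ξ, sqSum ξ ^ 2 ∂gaussVec d h ≤ ∫ ξ, d * ∑ i, ξ i ^ 4 ∂gaussVec d h :=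
        integral_mono integrable_sqSum_sq ((integrable_sum_pow_four (h := h)).const_mul (d : ℝ))
          fun ξ ↦ sqSum_sq_le ξ
    _ = d ^ 2 * gaussFourthMoment * (h : ℝ) ^ 2 := by
        rw [integral_const_mul, integral_finsetSum _ fun i _ ↦ gaussVec_integrable_pow i 4]
        simp [gaussVec_integral_pow_four]
        ring

/-- `E ξᵢ ξⱼ = h δᵢⱼ`. [folklore] -/
theorem gaussVec_integral_mul (i j : Fin d) :
    ∫ ξ, ξ i * ξ j ∂gaussVec d h = if i = j then (h : ℝ) else 0 := by
  split_ifs with hij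
  · subst hij
    simpa [pow_two] using gaussVec_integral_sq (h := h) i
  · exact gaussVec_integral_mul_of_ne hij

/-- `ξᵢ ξⱼ` is integrable. [folklore] -/
theorem gaussVec_integrable_mul (i j : Fin d) :
    Integrable (fun ξ : Fin d → ℝ ↦ ξ i * ξ j) (gaussVec d h) := by
  refine Integrable.mono' (((gaussVec_integrable_pow (h := h) i 2).add (gaussVec_integrable_pow j 2)))
    ((measurable_pi_apply i).mul (measurable_pi_apply j)).aestronglyMeasurable
    (Eventually.of_forall fun ξ ↦ ?_)
  simp only [Pi.add_apply, Real.norm_eq_abs, abs_mul]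
  nlinarith [sq_nonneg (|ξ i| - |ξ j|), sq_abs (ξ i), sq_abs (ξ j), abs_nonneg (ξ i),
    abs_nonneg (ξ j)]

/-! ### Second derivatives along segments; the Laplacian -/

/-- The standard basis vector `eᵢ` of `Fin d → ℝ`. [folklore] -/
def bvec (i : Fin d) : Fin d → ℝ := Pi.single i 1

/-- **The Hessian** `D²f(x)`, the second Fréchet derivative `fderiv (fderiv f) x`, as a bilinear
form. [folklore] -/
def hess (f : (Fin d → ℝ) → ℝ) (x : Fin d → ℝ) : (Fin d → ℝ) →L[ℝ] (Fin d → ℝ) →L[ℝ] ℝ :=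
  fderiv ℝ (fderiv ℝ f) x

/-- **The Laplacian** `Δf(x) = ∑ᵢ D²f(x)(eᵢ, eᵢ)`. [folklore] -/
def lap (f : (Fin d → ℝ) → ℝ) (x : Fin d → ℝ) : ℝ := ∑ i, hess f x (bvec i) (bvec i)

/-- Expansion of a vector in the standard basis: `ξ = ∑ᵢ ξᵢ eᵢ`. [folklore] -/
theorem eq_sum_smul_bvec (ξ : Fin d → ℝ) : ξ = ∑ i, ξ i • bvec i := by
  conv_lhs => rw [← Finset.univ_sum_single ξ]
  refine Finset.sum_congr rfl fun i _ ↦ ?_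
  rw [bvec, ← Pi.single_smul]
  simp

/-- A linear form in coordinates: `ℓ ξ = ∑ᵢ ξᵢ ℓ(eᵢ)`. [folklore] -/
theorem clm_apply_eq_sum (ℓ : (Fin d → ℝ) →L[ℝ] ℝ) (ξ : Fin d → ℝ) :
    ℓ ξ = ∑ i, ξ i * ℓ (bvec i) := by
  conv_lhs => rw [eq_sum_smul_bvec ξ]
  rw [map_sum]
  simp [smul_eq_mul]

/-- A bilinear form in coordinates: `L ξ ξ = ∑ᵢ ∑ⱼ ξᵢ ξⱼ L(eᵢ)(eⱼ)`. [folklore] -/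
theorem clm₂_apply_eq_sum (L : (Fin d → ℝ) →L[ℝ] (Fin d → ℝ) →L[ℝ] ℝ) (ξ : Fin d → ℝ) :
    L ξ ξ = ∑ i, ∑ j, ξ i * ξ j * L (bvec i) (bvec j) := by
  have h1 : L ξ ξ = ∑ j, ξ j * L ξ (bvec j) := clm_apply_eq_sum (L ξ) ξ
  have h2 : ∀ j, L ξ (bvec j) = ∑ i, ξ i * L (bvec i) (bvec j) := fun j ↦ by
    have := clm_apply_eq_sum (L.flip (bvec j)) ξ
    rw [ContinuousLinearMap.flip_apply] at this
    rw [this]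
    exact Finset.sum_congr rfl fun i _ ↦ by rw [ContinuousLinearMap.flip_apply]
  rw [h1]
  simp_rw [h2, Finset.mul_sum]
  rw [Finset.sum_comm]
  exact Finset.sum_congr rfl fun i _ ↦ Finset.sum_congr rfl fun j _ ↦ by ring

/-- `ξᵢ c` is integrable. [folklore] -/
theorem gaussVec_integrable_eval_mul_const (i : Fin d) (c : ℝ) :
    Integrable (fun ξ : Fin d → ℝ ↦ ξ i * c) (gaussVec d h) :=
  ((gaussVec_integrable_pow i 1).mul_const c).congr (Eventually.of_forall fun ξ ↦ by simp)

/-- `E ℓ(ξ) = 0` for every linear form `ℓ` (in particular `E Df(x)ξ = 0`). [folklore] -/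
theorem gaussVec_integral_clm (ℓ : (Fin d → ℝ) →L[ℝ] ℝ) : ∫ ξ, ℓ ξ ∂gaussVec d h = 0 := by
  rw [integral_congr_ae (Eventually.of_forall (clm_apply_eq_sum ℓ) :
    (fun ξ : Fin d → ℝ ↦ ℓ ξ) =ᵐ[gaussVec d h] fun ξ ↦ ∑ i, ξ i * ℓ (bvec i))]
  rw [integral_finsetSum _ fun i _ ↦ gaussVec_integrable_eval_mul_const i _]
  refine Finset.sum_eq_zero fun i _ ↦ ?_
  rw [integral_mul_const, gaussVec_integral_eval, zero_mul]

/-- Linear forms are integrable. [folklore] -/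
theorem gaussVec_integrable_clm (ℓ : (Fin d → ℝ) →L[ℝ] ℝ) :
    Integrable (fun ξ : Fin d → ℝ ↦ ℓ ξ) (gaussVec d h) := by
  have : (fun ξ : Fin d → ℝ ↦ ℓ ξ) = fun ξ ↦ ∑ i, ξ i * ℓ (bvec i) := funext (clm_apply_eq_sum ℓ)
  rw [this]
  exact integrable_finsetSum _ fun i _ ↦ gaussVec_integrable_eval_mul_const i _

/-- `E D²f(x)(ξ, ξ) = h Δ`-type identity: `E L(ξ, ξ) = h ∑ᵢ L(eᵢ, eᵢ)`. [folklore] -/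
theorem gaussVec_integral_clm₂ (L : (Fin d → ℝ) →L[ℝ] (Fin d → ℝ) →L[ℝ] ℝ) :
    ∫ ξ, L ξ ξ ∂gaussVec d h = h * ∑ i, L (bvec i) (bvec i) := by
  rw [integral_congr_ae (Eventually.of_forall (clm₂_apply_eq_sum L) :
    (fun ξ : Fin d → ℝ ↦ L ξ ξ) =ᵐ[gaussVec d h] fun ξ ↦ ∑ i, ∑ j, ξ i * ξ j * L (bvec i) (bvec j))]
  rw [integral_finsetSum _ fun i _ ↦ integrable_finsetSum _ fun j _ ↦
    (gaussVec_integrable_mul i j).mul_const _]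
  rw [Finset.mul_sum]
  refine Finset.sum_congr rfl fun i _ ↦ ?_
  rw [integral_finsetSum _ fun j _ ↦ (gaussVec_integrable_mul i j).mul_const _]
  simp_rw [integral_mul_const, gaussVec_integral_mul, ite_mul, zero_mul, Finset.sum_ite_eq,
    Finset.mem_univ, if_true]

/-- Quadratic forms are integrable. [folklore] -/
theorem gaussVec_integrable_clm₂ (L : (Fin d → ℝ) →L[ℝ] (Fin d → ℝ) →L[ℝ] ℝ) :
    Integrable (fun ξ : Fin d → ℝ ↦ L ξ ξ) (gaussVec d h) := by
  have : (fun ξ : Fin d → ℝ ↦ L ξ ξ) = fun ξ ↦ ∑ i, ∑ j, ξ i * ξ j * L (bvec i) (bvec j) :=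
    funext (clm₂_apply_eq_sum L)
  rw [this]
  exact integrable_finsetSum _ fun i _ ↦ integrable_finsetSum _ fun j _ ↦
    (gaussVec_integrable_mul i j).mul_const _

section Taylor

variable {f : (Fin d → ℝ) → ℝ}

/-- A `C²` function is differentiable. [folklore] -/
theorem hasFDerivAt_of_contDiff_two (hf : ContDiff ℝ 2 f) (y : Fin d → ℝ) :
    HasFDerivAt f (fderiv ℝ f y) y :=
  ((hf.differentiable (by simp)).differentiableAt).hasFDerivAt

/-- The derivative of a `C²` function is `C¹`. [folklore] -/
theorem contDiff_one_fderiv (hf : ContDiff ℝ 2 f) : ContDiff ℝ 1 (fderiv ℝ f) :=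
  hf.fderiv_right (m := 1) (by norm_num)

/-- The derivative of a `C²` function is differentiable, with derivative the Hessian. [folklore] -/
theorem hasFDerivAt_fderiv_of_contDiff_two (hf : ContDiff ℝ 2 f) (y : Fin d → ℝ) :
    HasFDerivAt (fderiv ℝ f) (hess f y) y :=
  (((contDiff_one_fderiv hf).differentiable (by simp)).differentiableAt).hasFDerivAt

/-- The Hessian of a `C²` function is continuous. [folklore] -/
theorem continuous_hess (hf : ContDiff ℝ 2 f) : Continuous (hess f) :=
  (contDiff_one_fderiv hf).continuous_fderiv (by simp)

/-- The Laplacian of a `C²` function is continuous. [folklore] -/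
theorem continuous_lap (hf : ContDiff ℝ 2 f) : Continuous (lap f) := by
  unfold lap
  refine continuous_finsetSum _ fun i _ ↦ ?_
  exact ((ContinuousLinearMap.apply ℝ ℝ (bvec i)).continuous.comp
    ((ContinuousLinearMap.apply ℝ _ (bvec i)).continuous.comp (continuous_hess hf)))

/-- The Hessian of a compactly supported function is compactly supported. [folklore] -/
theorem hasCompactSupport_hess (hc : HasCompactSupport f) : HasCompactSupport (hess f) :=
  (hc.fderiv ℝ).fderiv ℝ

/-- **The matrix of the Hessian** in the standard basis, `(i, j) ↦ D²f(y)(eᵢ, eⱼ)`, as a map into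
the sup-normed space `Fin d × Fin d → ℝ` (we deliberately avoid the operator-norm topology of the
space of bilinear forms). [folklore] -/
def hessMat (f : (Fin d → ℝ) → ℝ) (y : Fin d → ℝ) : Fin d × Fin d → ℝ :=
  fun p ↦ hess f y (bvec p.1) (bvec p.2)

/-- The Hessian matrix of a `C²` function is continuous. [folklore] -/
theorem continuous_hessMat (hf : ContDiff ℝ 2 f) : Continuous (hessMat f) := by
  refine continuous_pi fun p ↦ ?_
  exact ((ContinuousLinearMap.apply ℝ ℝ (bvec p.2)).continuous.comp
    ((ContinuousLinearMap.apply ℝ _ (bvec p.1)).continuous.comp (continuous_hess hf)))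

/-- The Hessian matrix of a compactly supported function is compactly supported. [folklore] -/
theorem hasCompactSupport_hessMat (hc : HasCompactSupport f) : HasCompactSupport (hessMat f) := by
  have : hessMat f = (fun L : (Fin d → ℝ) →L[ℝ] (Fin d → ℝ) →L[ℝ] ℝ ↦
      fun p : Fin d × Fin d ↦ L (bvec p.1) (bvec p.2)) ∘ hess f := rfl
  rw [this]
  exact (hasCompactSupport_hess hc).comp_left (by ext p; simp)

/-- The difference of Hessians on the diagonal in coordinates. [folklore] -/
theorem hess_sub_apply_eq_sum (y x ξ : Fin d → ℝ) :
    hess f y ξ ξ - hess f x ξ ξ = ∑ i, ∑ j, ξ i * ξ j * (hessMat f y (i, j) - hessMat f x (i, j)) := by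
  have := clm₂_apply_eq_sum (hess f y - hess f x) ξ
  simp only [sub_apply] at this
  rw [this]
  rfl

/-- `|D²f(y)(ξ,ξ) − D²f(x)(ξ,ξ)| ≤ d² C ‖ξ‖²` when the Hessian matrices differ by at most `C`
entrywise. [folklore] -/
theorem abs_hess_sub_apply_le {y x ξ : Fin d → ℝ} {C : ℝ}
    (hC : ∀ i j, |hessMat f y (i, j) - hessMat f x (i, j)| ≤ C) :
    |hess f y ξ ξ - hess f x ξ ξ| ≤ d ^ 2 * C * ‖ξ‖ ^ 2 := by
  rw [hess_sub_apply_eq_sum]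
  have hξ : ∀ i, |ξ i| ≤ ‖ξ‖ := fun i ↦ by simpa [Real.norm_eq_abs] using norm_le_pi_norm ξ i
  calc |∑ i, ∑ j, ξ i * ξ j * (hessMat f y (i, j) - hessMat f x (i, j))|
      ≤ ∑ i, |∑ j, ξ i * ξ j * (hessMat f y (i, j) - hessMat f x (i, j))| := Finset.abs_sum_le_sum_abs _ _
    _ ≤ ∑ i, ∑ j, |ξ i * ξ j * (hessMat f y (i, j) - hessMat f x (i, j))| :=
        Finset.sum_le_sum fun i _ ↦ Finset.abs_sum_le_sum_abs _ _
    _ ≤ ∑ i : Fin d, ∑ j : Fin d, ‖ξ‖ * ‖ξ‖ * C := by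
        refine Finset.sum_le_sum fun i _ ↦ Finset.sum_le_sum fun j _ ↦ ?_
        rw [abs_mul, abs_mul]
        have hC0 : 0 ≤ C := (abs_nonneg _).trans (hC i j)
        exact mul_le_mul (mul_le_mul (hξ i) (hξ j) (abs_nonneg _) (norm_nonneg _)) (hC i j)
          (abs_nonneg _) (mul_nonneg (norm_nonneg _) (norm_nonneg _))
    _ = d ^ 2 * C * ‖ξ‖ ^ 2 := by simp; ring

/-- **Second-order Taylor expansion along a segment**: if
`|D²f(x + tξ)(ξ,ξ) − D²f(x)(ξ,ξ)| ≤ B` for `t ∈ [0, 1]`, then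
`|f(x + ξ) − f(x) − Df(x)ξ − ½ D²f(x)(ξ, ξ)| ≤ B` (two applications of the mean value
inequality to `t ↦ f(x + tξ)`). [folklore] -/
theorem abs_sub_taylor_two_le (hf : ContDiff ℝ 2 f) {x ξ : Fin d → ℝ} {B : ℝ}
    (hB : ∀ t ∈ Icc (0 : ℝ) 1, |hess f (x + t • ξ) ξ ξ - hess f x ξ ξ| ≤ B) :
    |f (x + ξ) - f x - fderiv ℝ f x ξ - 1 / 2 * hess f x ξ ξ| ≤ B := by
  have hB0 : 0 ≤ B := (abs_nonneg _).trans (hB 0 ⟨le_rfl, zero_le_one⟩)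
  set γ : ℝ → (Fin d → ℝ) := fun t ↦ x + t • ξ with hγdef
  have hγ : ∀ t, HasDerivAt γ ξ t := fun t ↦ by
    have := ((hasDerivAt_id t).smul_const ξ).const_add x
    simpa [hγdef] using this
  set g : ℝ → ℝ := fun t ↦ f (γ t) with hgdef
  set g' : ℝ → ℝ := fun t ↦ fderiv ℝ f (γ t) ξ with hg'def
  have hg : ∀ t, HasDerivAt g (g' t) t := fun t ↦
    (hasFDerivAt_of_contDiff_two hf (γ t)).comp_hasDerivAt t (hγ t)
  have hg' : ∀ t, HasDerivAt g' (hess f (γ t) ξ ξ) t := fun t ↦ by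
    have h1 : HasDerivAt (fun s ↦ fderiv ℝ f (γ s)) (hess f (γ t) ξ) t :=
      (hasFDerivAt_fderiv_of_contDiff_two hf (γ t)).comp_hasDerivAt t (hγ t)
    have h2 := h1.clm_apply (hasDerivAt_const t ξ)
    simpa using h2
  set c : ℝ := hess f x ξ ξ with hcdef
  -- level 1: `ψ t = g' t - g' 0 - t c`
  set ψ : ℝ → ℝ := fun t ↦ g' t - g' 0 - t * c with hψdef
  have hψ : ∀ t, HasDerivAt ψ (hess f (γ t) ξ ξ - c) t := fun t ↦ by
    have := ((hg' t).sub_const (g' 0)).fun_sub ((hasDerivAt_id t).mul_const c)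
    simpa [hψdef] using this
  have hψbound : ∀ t ∈ Icc (0 : ℝ) 1, |ψ t| ≤ B := by
    intro t ht
    have hmv := norm_image_sub_le_of_norm_deriv_le_segment' (f := ψ) (a := 0) (b := 1)
      (C := B) (fun s _ ↦ (hψ s).hasDerivWithinAt) (fun s hs ↦ ?_) t ht
    · have hψ0 : ψ 0 = 0 := by simp [hψdef]
      rw [hψ0, sub_zero, Real.norm_eq_abs, sub_zero] at hmv
      calc |ψ t| ≤ B * t := hmv
        _ ≤ B * 1 := by gcongr; exact ht.2
        _ = B := mul_one _
    · rw [hcdef, Real.norm_eq_abs]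
      exact hB s ⟨hs.1, hs.2.le⟩
  -- level 2: `φ t = g t - g 0 - t g'(0) - (t²/2) c`
  set φ : ℝ → ℝ := fun t ↦ g t - g 0 - t * g' 0 - t ^ 2 / 2 * c with hφdef
  have hφ : ∀ t, HasDerivAt φ (ψ t) t := fun t ↦ by
    have h3 : HasDerivAt (fun t : ℝ ↦ t ^ 2 / 2 * c) (t * c) t := by
      have := ((hasDerivAt_pow 2 t).div_const 2).mul_const c
      simpa [pow_one] using this
    have := (((hg t).sub_const (g 0)).fun_sub ((hasDerivAt_id t).mul_const (g' 0))).fun_sub h3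
    simpa [hφdef, hψdef] using this
  have hmv := norm_image_sub_le_of_norm_deriv_le_segment' (f := φ) (a := 0) (b := 1)
    (C := B) (fun s _ ↦ (hφ s).hasDerivWithinAt) (fun s hs ↦ ?_) 1 ⟨zero_le_one, le_rfl⟩
  · have hφ0 : φ 0 = 0 := by simp [hφdef]
    rw [hφ0, sub_zero, Real.norm_eq_abs, sub_zero, mul_one] at hmv
    have hφ1 : φ 1 = f (x + ξ) - f x - fderiv ℝ f x ξ - 1 / 2 * hess f x ξ ξ := by
      simp [hφdef, hgdef, hg'def, hγdef, hcdef]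
    rwa [hφ1] at hmv
  · rw [Real.norm_eq_abs]
    exact hψbound s ⟨hs.1, hs.2.le⟩

/-- The remainder bound used under the Gaussian integral: with `M` a bound for the entries of the
Hessian matrix, `δ` a modulus of uniform continuity of the Hessian matrix for `η`, and
`S = ∑ ξᵢ²`: `|f(x+ξ) − f(x) − Df(x)ξ − ½D²f(x)(ξ,ξ)| ≤ d²η S + (2d²M/δ²) S²`. [folklore] -/
theorem abs_sub_taylor_two_le_sqSum (hf : ContDiff ℝ 2 f) {x ξ : Fin d → ℝ} {η δ M : ℝ}
    (hδ : 0 < δ) (hη0 : 0 ≤ η) (hM0 : 0 ≤ M) (hM : ∀ y i j, |hessMat f y (i, j)| ≤ M)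
    (hη : ∀ y y', ‖y - y'‖ < δ → ∀ i j, |hessMat f y (i, j) - hessMat f y' (i, j)| ≤ η) :
    |f (x + ξ) - f x - fderiv ℝ f x ξ - 1 / 2 * hess f x ξ ξ| ≤
      d ^ 2 * η * sqSum ξ + 2 * d ^ 2 * M / δ ^ 2 * sqSum ξ ^ 2 := by
  have hS0 := sqSum_nonneg ξ
  by_cases hξ : ‖ξ‖ < δ
  · have hB : ∀ t ∈ Icc (0 : ℝ) 1, |hess f (x + t • ξ) ξ ξ - hess f x ξ ξ| ≤ d ^ 2 * η * ‖ξ‖ ^ 2 :=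
      fun t ht ↦ abs_hess_sub_apply_le (hη _ _ (by
        rw [add_sub_cancel_left, norm_smul, Real.norm_eq_abs, abs_of_nonneg ht.1]
        calc t * ‖ξ‖ ≤ 1 * ‖ξ‖ := by gcongr; exact ht.2
          _ < δ := by rw [one_mul]; exact hξ))
    calc |f (x + ξ) - f x - fderiv ℝ f x ξ - 1 / 2 * hess f x ξ ξ| ≤ d ^ 2 * η * ‖ξ‖ ^ 2 :=
          abs_sub_taylor_two_le hf hB
      _ ≤ d ^ 2 * η * sqSum ξ := by gcongr; exact norm_sq_le_sqSum ξ
      _ ≤ d ^ 2 * η * sqSum ξ + 2 * d ^ 2 * M / δ ^ 2 * sqSum ξ ^ 2 :=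
          le_add_of_nonneg_right (by positivity)
  · have hB : ∀ t ∈ Icc (0 : ℝ) 1, |hess f (x + t • ξ) ξ ξ - hess f x ξ ξ| ≤ d ^ 2 * (2 * M) * ‖ξ‖ ^ 2 :=
      fun t _ ↦ abs_hess_sub_apply_le fun i j ↦ (abs_sub _ _).trans (by
        linarith [hM (x + t • ξ) i j, hM x i j])
    have h1 := abs_sub_taylor_two_le hf hB
    have hδξ : δ ≤ ‖ξ‖ := not_lt.1 hξ
    have hS : δ ^ 2 ≤ sqSum ξ := (pow_le_pow_left₀ hδ.le hδξ 2).trans (norm_sq_le_sqSum ξ)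
    calc |f (x + ξ) - f x - fderiv ℝ f x ξ - 1 / 2 * hess f x ξ ξ| ≤ d ^ 2 * (2 * M) * ‖ξ‖ ^ 2 := h1
      _ ≤ d ^ 2 * (2 * M) * sqSum ξ := by gcongr; exact norm_sq_le_sqSum ξ
      _ ≤ 2 * d ^ 2 * M / δ ^ 2 * sqSum ξ ^ 2 := by
          rw [div_mul_eq_mul_div, le_div_iff₀ (by positivity)]
          have h2 : 0 ≤ d ^ 2 * (2 * M) * sqSum ξ := by positivity
          nlinarith
      _ ≤ d ^ 2 * η * sqSum ξ + 2 * d ^ 2 * M / δ ^ 2 * sqSum ξ ^ 2 :=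
          le_add_of_nonneg_left (by positivity)

/-- A `C²` function with compact support is bounded. [folklore] -/
theorem exists_bound_of_hasCompactSupport (hf : ContDiff ℝ 2 f) (hc : HasCompactSupport f) :
    ∃ C, ∀ y, |f y| ≤ C := by
  obtain ⟨C, hC⟩ := hf.continuous.bounded_above_of_compact_support hc
  exact ⟨C, fun y ↦ by simpa [Real.norm_eq_abs] using hC y⟩

/-- `ξ ↦ f(x + ξ)` is integrable for `f ∈ C²_c`. [folklore] -/
theorem integrable_comp_add (hf : ContDiff ℝ 2 f) (hc : HasCompactSupport f) (x : Fin d → ℝ) :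
    Integrable (fun ξ : Fin d → ℝ ↦ f (x + ξ)) (gaussVec d h) := by
  obtain ⟨C, hC⟩ := exists_bound_of_hasCompactSupport hf hc
  exact Integrable.mono' (integrable_const C)
    ((hf.continuous.comp (continuous_const.add continuous_id)).aestronglyMeasurable)
    (Eventually.of_forall fun ξ ↦ by simpa [Real.norm_eq_abs] using hC (x + ξ))

/-- **The one-step Gaussian estimate (generator of the Brownian semigroup on `C²_c`).** For
`f : ℝᵈ → ℝ` of class `C²` with compact support and `ε > 0` there is `h₀ > 0` such that for
every `h < h₀` and EVERY `x`,
`|E f(x + ξ) − f(x) − (h/2) Δf(x)| ≤ ε h` for `ξ ~ N(0, h I_d)`. [folklore] -/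
theorem gaussVec_integral_taylor (hf : ContDiff ℝ 2 f) (hc : HasCompactSupport f) {ε : ℝ}
    (hε : 0 < ε) :
    ∃ h₀ : ℝ, 0 < h₀ ∧ ∀ h : ℝ≥0, (h : ℝ) < h₀ → ∀ x,
      |∫ ξ, f (x + ξ) ∂gaussVec d h - f x - (h : ℝ) / 2 * lap f x| ≤ ε * h := by
  -- a bound and a modulus of uniform continuity for the Hessian matrix
  obtain ⟨M, hM'⟩ := (continuous_hessMat hf).bounded_above_of_compact_support
    (hasCompactSupport_hessMat hc)
  have hM : ∀ y i j, |hessMat f y (i, j)| ≤ M := fun y i j ↦ by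
    have := norm_le_pi_norm (hessMat f y) (i, j)
    rw [Real.norm_eq_abs] at this
    exact this.trans (hM' y)
  set η : ℝ := ε / (2 * d ^ 3 + 2) with hηdef
  have hη : 0 < η := by positivity
  obtain ⟨δ, hδ, hδη⟩ := Metric.uniformContinuous_iff.1
    ((hasCompactSupport_hessMat hc).uniformContinuous_of_continuous (continuous_hessMat hf)) η hη
  have hηuc : ∀ y y', ‖y - y'‖ < δ → ∀ i j, |hessMat f y (i, j) - hessMat f y' (i, j)| ≤ η := by
    intro y y' hyy' i j
    rw [← dist_eq_norm] at hyy'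
    have h1 := (hδη hyy').le
    rw [dist_eq_norm] at h1
    have h2 := norm_le_pi_norm (hessMat f y - hessMat f y') (i, j)
    rw [Pi.sub_apply, Real.norm_eq_abs] at h2
    exact h2.trans h1
  have hm₄ := gaussFourthMoment_nonneg
  have hM0 : 0 ≤ M := (norm_nonneg (hessMat f 0)).trans (hM' 0)
  set C₂ : ℝ := 2 * d ^ 2 * M / δ ^ 2 * (d ^ 2 * gaussFourthMoment) with hC₂def
  have hC₂0 : 0 ≤ C₂ := by positivity
  refine ⟨ε / (2 * C₂ + 2), by positivity, fun h hh x ↦ ?_⟩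
  have hh0 : (0 : ℝ) ≤ h := h.coe_nonneg
  set μ := gaussVec d h with hμ
  -- the remainder
  set R : (Fin d → ℝ) → ℝ := fun ξ ↦ f (x + ξ) - f x - fderiv ℝ f x ξ - 1 / 2 * hess f x ξ ξ
    with hRdef
  have hint_f : Integrable (fun ξ ↦ f (x + ξ)) μ := integrable_comp_add hf hc x
  have hint1 : Integrable (fun ξ : Fin d → ℝ ↦ f (x + ξ) - f x) μ := hint_f.sub (integrable_const _)
  have hint2 : Integrable (fun ξ : Fin d → ℝ ↦ f (x + ξ) - f x - fderiv ℝ f x ξ) μ :=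
    hint1.sub (gaussVec_integrable_clm _)
  have hint3 : Integrable (fun ξ : Fin d → ℝ ↦ 1 / 2 * hess f x ξ ξ) μ :=
    (gaussVec_integrable_clm₂ _).const_mul _
  have hR : Integrable R μ := hint2.sub hint3
  have key : ∫ ξ, f (x + ξ) ∂μ - f x - (h : ℝ) / 2 * lap f x = ∫ ξ, R ξ ∂μ := by
    rw [hRdef, integral_sub hint2 hint3, integral_sub hint1 (gaussVec_integrable_clm _),
      integral_sub hint_f (integrable_const _), integral_const, gaussVec_integral_clm,
      integral_const_mul, gaussVec_integral_clm₂]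
    simp only [probReal_univ, one_smul, sub_zero, lap]
    ring
  rw [key]
  -- integrate the pointwise bound
  have hbound_int : Integrable
      (fun ξ : Fin d → ℝ ↦ d ^ 2 * η * sqSum ξ + 2 * d ^ 2 * M / δ ^ 2 * sqSum ξ ^ 2) μ :=
    (integrable_sqSum.const_mul _).add (integrable_sqSum_sq.const_mul _)
  calc |∫ ξ, R ξ ∂μ| ≤ ∫ ξ, |R ξ| ∂μ := abs_integral_le_integral_abs
    _ ≤ ∫ ξ, d ^ 2 * η * sqSum ξ + 2 * d ^ 2 * M / δ ^ 2 * sqSum ξ ^ 2 ∂μ :=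
        integral_mono hR.abs hbound_int fun ξ ↦
          abs_sub_taylor_two_le_sqSum hf hδ hη.le hM0 hM hηuc
    _ = d ^ 2 * η * (d * h) + 2 * d ^ 2 * M / δ ^ 2 * ∫ ξ, sqSum ξ ^ 2 ∂μ := by
        rw [integral_add (integrable_sqSum.const_mul _) (integrable_sqSum_sq.const_mul _),
          integral_const_mul, integral_const_mul, gaussVec_integral_sqSum]
    _ ≤ d ^ 2 * η * (d * h) + 2 * d ^ 2 * M / δ ^ 2 * (d ^ 2 * gaussFourthMoment * (h : ℝ) ^ 2) := by
        gcongr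
        exact gaussVec_integral_sqSum_sq_le
    _ = (η * d ^ 3) * h + (C₂ * h) * h := by rw [hC₂def]; ring
    _ ≤ ε / 2 * h + ε / 2 * h := by
        gcongr
        · rw [hηdef, div_mul_eq_mul_div, div_le_div_iff₀ (by positivity) (by positivity)]
          nlinarith
        · have h3 : C₂ * (h : ℝ) ≤ C₂ * (ε / (2 * C₂ + 2)) := by gcongr
          refine h3.trans ?_
          rw [mul_div_assoc', div_le_div_iff₀ (by positivity) (by positivity)]
          nlinarith
    _ = ε * h := by ring

end Taylor

end Literature.Probability.Process

end
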